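import Summits.BirchSwinnertonDyer.BirchSwinnertonDyer.Theses.InertBadSignedBranches
import Summits.BirchSwinnertonDyer.Rank1Residual.X12.CMTamagawaThreeAll
import Summits.BirchSwinnertonDyer.Rank1Residual.X12.ClassClosureO10RubinEta
import HarnessLib

/-!
# Route `InertBadSignedBranches` (rung K8), D71 child `InertBadAtThreeIstarZero` (stmt-BirchSwinnertonDyer-19656):
# the child at `p = 3` FROM the lower half on the type `(3, I₀*)` and the Manin datum at `3` — no
# C-cc-1@3, no (C1_η)@3, no readings, no period datum
# (helper `--supports` 19656; cell bsd-cm, seat bsd-cm-inert g11; nothing asserted)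

g10's helpers (p410974 / p410975 / p411853) turn the child into «kernel modulo C-cc-1@3 (pair form or
(GZ_η-VAL)@3) ∧ (C1_η)@3 ∧ readings ∧ named facts ∧ hper@3». THIS FILE records the OTHER normal form,
the Kolyvagin-side one, which the tree already had for the congruent-number family (g7,
`X12/CongruentNumberOddPart.lean` §2 (b)): on the type `(3, I₀*)` (CM, `3` inert in `K ∈ {ℚ(i), ℚ(√−7),
ℚ(√−19), ℚ(√−43), ℚ(√−67), ℚ(√−163)}`, bad, Kodaira `I₀*` at `3`; O10-PS@3, 57 census classes) the UPPER
half of `BSD(W, 3)` is a theorem of the published record modulo ONLY the Manin datum `3 ∤ c(D)`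
(x1b gen 12 / harvest-1: `X12.missingUpperBoundAt_three_of_classX12_of_bad'` — Kolyvagin's bound in
Matar–Nekovář's irreducible form over a Friedberg–Hoffstein field, the CM rank-zero triple for the
twist, GZK, modularity; the Tamagawa side condition `3 ∤ ∏ c_ℓ` DISCHARGED for every CM field
`≠ ℚ(√−3)` by `not_three_dvd_tamagawaProduct_of_hasCM_of_not_cmRamified_three`). Hence:

* §1 per pair: `Typed.X12.MissingInputAt W 3` ⟸ `MissingLowerBoundAt W 3` + the eight published facts
  + a parametrisation datum `D` of `W` at the conductor level with `3 ∤ c(D)`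
  (`missingInputAt_three_IstarZero_of_lower`); and ⟸ a certified `3`-adic unit `#Ш(W)_an`
  (`…_of_shaAn_unit`, route T-KR@3: x1b's 150/154 per-pair closures use exactly this);
* §2 class level: **`InertBadAtThreeIstarZero` ⟸ `X12.O10.LowerHalfOnType 3 I₀*` + the eight facts + the
  Manin datum on the type** (`inertBadAtThreeIstarZero_of_lowerHalfOnType_three`). So the child's open
  content is the main-conjecture half of `BSD₃` on `(3, I₀*)` plus the Manin datum at the additive
  prime `3` (no Mazur — `3 ∣ N` —, no Edixhoven — `3 ≤ 7` —; Cremona's table per pair), exactly as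
  for the crux at `p ≥ 5` (`CccOneLowerHalf.cccOneLawAt_iff_lowerHalfOnType_of_seven_lt`, p415634).

HONEST LABEL: CONDITIONAL on displayed hypotheses; `LowerHalfOnType 3 I₀*` is the OPEN class target
(RULING D56: at `3` it is PROP 5.6_η at the ramification boundary `e = p − 1`); nothing is booked; no
label moves; 19656 and O10@3 stay OPEN at class level. What this is NOT: not a proof of any lower half;
no new typed input; no Literature statement, no named fact minted.
[cite: MatarNekovar2019, Thm. 0.3 and §0.11] [cite: SilvermanATAEC1994, IV.9.4 and Table 4.1]
[cite: Miller2011LMS, §1 and Def. 1.1] [cite: BurungaleFlach2024, Thm. 1.1 and Cor. 2]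
-/

set_option autoImplicit false
set_option linter.dupNamespace false

noncomputable section

open scoped Classical NumberField

open WeierstrassCurve NumberField IsDedekindDomain
open Literature.NumberTheory.EllipticCurves
open Literature.NumberTheory.EllipticCurves.ModularForms
open Literature.NumberTheory.EllipticCurves.Rank1Residual
open Literature.NumberTheory.EllipticCurves.Rank1Residual.Typed
open Summit.BirchSwinnertonDyer.Rank1Residual
open Summit.BirchSwinnertonDyer.Rank1Residual.X12.O10

namespace Summit.BirchSwinnertonDyer.BirchSwinnertonDyer.Theorems.InertBadOddLowerHalf

section Facts

/-! The PUBLISHED named facts of the upper half at `3` (exactly those of `X12/CMTamagawaThreeAll.lean` §3). -/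
variable
  (hGZ : ∀ (N : ℕ) [NeZero N] (W : WeierstrassCurve ℚ) (K : Type) [Field K] [NumberField K],
    gross_zagier N W K)
  (hKo : ∀ (N : ℕ) [NeZero N] (W : WeierstrassCurve ℚ) (K : Type) [Field K] [NumberField K],
    kolyvagin N W K)
  (hMN : ∀ (N : ℕ) [NeZero N] (W : WeierstrassCurve ℚ) (K : Type) [Field K] [NumberField K],
    MatarNekovar2019.thm03_padicValNat_card_sha_le_of_irreducible N W K)
  (hGZK : rank_eq_analyticRank_of_analyticRank_le_one) (hmod : hasEntireLFunction_rat)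
  (hnf : exists_isNewformOf) (hFH : friedbergHoffstein_exists_heegnerField_split_twist_ne_zero)
  (hCM8 : bsdTriple_of_hasCM_of_L_one_ne_zero)

include hGZ hKo hMN hGZK hmod hnf hFH hCM8

/-! ## §1 Per pair at `(3, I₀*)` -/

/-- **`BSD(W, 3)` on the type `(3, I₀*)` from the pair's OWN lower half and the Manin datum** — x1b's
`X12.bsdp_three_of_classX12_of_bad_of_lower'` keyed by the signed type (`ClassX12 W 3`, bad, `3 ∤ d_K`
are read off `HasSignedLocalType W 3 I₀*` and `r_an = 1`). CONDITIONAL; nothing booked.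
[cite: MatarNekovar2019, Thm. 0.3 and §0.11] [cite: Miller2011LMS, §1 and Def. 1.1] -/
theorem bsdp_three_IstarZero_of_lower (W : WeierstrassCurve ℚ) [W.IsElliptic] [W.IsGloballyMinimal]
    [Fact (Nat.Prime 3)] [NeZero (W.conductorNorm ℤ)]
    (hT : HasSignedLocalType W 3 (.Istar 0)) (hr : W.analyticRank = 1)
    (D : ModularParametrizationData W (W.conductorNorm ℤ)) (hc : ¬ (3 : ℤ) ∣ D.c)
    (hlow : MissingLowerBoundAt W 3) : BSDp W 3 :=
  X12.bsdp_three_of_classX12_of_bad_of_lower' hGZ hKo hMN hGZK hmod hnf hFH hCM8 W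
    (classX12_of_hasSignedLocalType W 3 hT hr) hT.2.2.1 hT.2.1.1 D hc hlow

/-- **The child's conclusion `Typed.X12.MissingInputAt W 3` at a pair of the type `(3, I₀*)` ⟸ the
pair's lower half + the Manin datum + the eight published facts.** CONDITIONAL; nothing booked.
[cite: MatarNekovar2019, Thm. 0.3 and §0.11] [cite: Miller2011LMS, §1 and Def. 1.1] -/
theorem missingInputAt_three_IstarZero_of_lower (W : WeierstrassCurve ℚ) [W.IsElliptic]
    [W.IsGloballyMinimal] [Fact (Nat.Prime 3)] [NeZero (W.conductorNorm ℤ)]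
    (hT : HasSignedLocalType W 3 (.Istar 0)) (hr : W.analyticRank = 1)
    (D : ModularParametrizationData W (W.conductorNorm ℤ)) (hc : ¬ (3 : ℤ) ∣ D.c)
    (hlow : MissingLowerBoundAt W 3) : X12.MissingInputAt W 3 := by
  have hB := bsdp_three_IstarZero_of_lower hGZ hKo hMN hGZK hmod hnf hFH hCM8 W hT hr D hc hlow
  haveI : Finite W.sha := (hGZK W (by rw [hr])).2
  exact fun _ ↦ missingPPartAt_of_bsdp W 3 hB

/-- **Route T-KR@3 keyed by the signed type: `Typed.X12.MissingInputAt W 3` ⟸ a CERTIFIED `3`-adic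
unit `#Ш(W)_an`** (+ the Manin datum + the eight facts) — the per-pair lever of the 57 O10-PS@3
census classes (x1b `bsdp_three_of_classX12_of_bad_of_shaAn_unit'`). PER PAIR; CONDITIONAL; nothing booked.
[cite: MatarNekovar2019, Thm. 0.3 and §0.11] [cite: Miller2011LMS, §1 and Def. 1.1] -/
theorem missingInputAt_three_IstarZero_of_shaAn_unit (W : WeierstrassCurve ℚ) [W.IsElliptic]
    [W.IsGloballyMinimal] [Fact (Nat.Prime 3)] [NeZero (W.conductorNorm ℤ)]
    (hT : HasSignedLocalType W 3 (.Istar 0)) (hr : W.analyticRank = 1)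
    (D : ModularParametrizationData W (W.conductorNorm ℤ)) (hc : ¬ (3 : ℤ) ∣ D.c)
    {q : ℚ} (hq : shaAn W = (q : ℂ)) (hv : padicValRat 3 q = 0) : X12.MissingInputAt W 3 := by
  have hB := X12.bsdp_three_of_classX12_of_bad_of_shaAn_unit' hGZ hKo hMN hGZK hmod hnf hFH hCM8 W
    (classX12_of_hasSignedLocalType W 3 hT hr) hT.2.2.1 hT.2.1.1 D hc hq hv
  haveI : Finite W.sha := (hGZK W (by rw [hr])).2
  exact fun _ ↦ missingPPartAt_of_bsdp W 3 hB

/-! ## §2 Class level: the child ⟸ `LowerHalfOnType 3 I₀*` + the Manin datum on the type -/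

/-- **`InertBadAtThreeIstarZero` (19656) ⟸ `X12.O10.LowerHalfOnType 3 I₀*` + the eight published
facts + the Manin datum on the type** (`hManin`: every rank-one `W` of signed type `(3, I₀*)` has a
parametrisation datum at the conductor level with `3 ∤ c(D)` — per pair Cremona's table; no class-level
theorem at the additive prime `3`). So the child's open content is the main-conjecture half of `BSD₃`
on `(3, I₀*)` and that datum. CONDITIONAL; nothing booked; 19656 / O10@3 stay OPEN at class level.
[cite: MatarNekovar2019, Thm. 0.3 and §0.11] [cite: Miller2011LMS, §1 and Def. 1.1]
[cite: SilvermanATAEC1994, IV.9.4 and Table 4.1] -/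
theorem inertBadAtThreeIstarZero_of_lowerHalfOnType_three
    (hManin : ∀ (W : WeierstrassCurve ℚ) [W.IsElliptic] [W.IsGloballyMinimal] [Fact (Nat.Prime 3)]
      [NeZero (W.conductorNorm ℤ)], HasSignedLocalType W 3 (.Istar 0) → W.analyticRank = 1 →
      ∃ D : ModularParametrizationData W (W.conductorNorm ℤ), ¬ (3 : ℤ) ∣ D.c)
    (hlow : LowerHalfOnType 3 (.Istar 0)) :
    Summit.BirchSwinnertonDyer.BirchSwinnertonDyer.Theses.InertBadSignedBranches.InertBadAtThreeIstarZero := by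
  unfold Summit.BirchSwinnertonDyer.BirchSwinnertonDyer.Theses.InertBadSignedBranches.InertBadAtThreeIstarZero
  intro W _ _ _ hT hr
  haveI : NeZero (W.conductorNorm ℤ) := ⟨(W.conductorNorm_pos_holds).ne'⟩
  obtain ⟨D, hc⟩ := hManin W hT hr
  exact missingInputAt_three_IstarZero_of_lower hGZ hKo hMN hGZK hmod hnf hFH hCM8 W hT hr D hc
    (hlow W hT hr)

end Facts

end Summit.BirchSwinnertonDyer.BirchSwinnertonDyer.Theorems.InertBadOddLowerHalf

end
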